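import Mathlib

/-!
# `AbelianNoGo` — simultaneous diagonalisation of a finite abelian matrix group

Route `MatrixMultiplication/OrbitHarmonicsHosts`, support item `stmt-MatrixMultiplication-5456`
(`AbelianNoGo`).  For a finite abelian group `Γ` and a representation `ρ : Γ →* GL_N(ℂ)`:

* `exists_weight_basis`: `ℂ^N` has a basis of simultaneous eigenvectors of all `ρ(g)`
  (Mathlib's simultaneous triangularisation of commuting families,
  `Module.End.iSup_iInf_maxGenEigenspace_eq_top_of_iSup_maxGenEigenspace_eq_top_of_commute`,
  plus `maxGenEigenspace = eigenspace` for the semisimple endomorphisms `ρ(g)` — roots of the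
  separable polynomial `X^|Γ| - 1` —, collected into a basis with
  `DirectSum.IsInternal.collectedBasis`);
* `exists_diagonalizer`: hence there are mutually inverse matrices `S, T` and eigencharacters
  `p : Fin N → (Γ →* ℂˣ)` with `T ρ(g) S = diag (p_s(g))_s` for all `g`.

Standard representation theory of finite abelian groups (every representation is a sum of
characters); Mathlib has the ingredients but not the statement.
-/

-- single-conjunct summit: the mandated namespace repeats `MatrixMultiplication`.
set_option linter.dupNamespace false

namespace Summit.MatrixMultiplication.MatrixMultiplication.Theorems

namespace AbelianNoGo

open Polynomial

variable {Γ : Type*} [CommGroup Γ] [Fintype Γ] {N : ℕ}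

/-- **Simultaneous eigenbasis.** A representation of a finite abelian group on `ℂ^N` admits a
basis of common eigenvectors: `ρ(g) b_s = w_s(g) b_s`. [folklore] -/
theorem exists_weight_basis (ρ : Γ →* GL (Fin N) ℂ) :
    ∃ (b : Module.Basis (Fin N) ℂ (Fin N → ℂ)) (w : Fin N → Γ → ℂ),
      ∀ s g, (ρ g : Matrix (Fin N) (Fin N) ℂ).mulVec (b s) = w s g • b s := by
  classical
  let F : Γ →* Module.End ℂ (Fin N → ℂ) :=
    (MonoidHomClass.toMonoidHom
      (Matrix.toLinAlgEquiv' : Matrix (Fin N) (Fin N) ℂ ≃ₐ[ℂ] Module.End ℂ (Fin N → ℂ))).comp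
      ((Units.coeHom (Matrix (Fin N) (Fin N) ℂ)).comp ρ)
  have hF : ∀ g x, F g x = (ρ g : Matrix (Fin N) (Fin N) ℂ).mulVec x := fun g x => by
    simp [F, Matrix.toLinAlgEquiv'_apply]
  have hcomm' : ∀ g h, Commute (F g) (F h) := by
    intro g h
    change F g * F h = F h * F g
    rw [← map_mul, ← map_mul, mul_comm]
  have hcomm : Pairwise fun g h => Commute (F g) (F h) := fun g h _ => hcomm' g h
  have hss : ∀ g, (F g).IsSemisimple := by
    intro g
    refine Module.End.isSemisimple_of_squarefree_aeval_eq_zero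
      (p := X ^ Fintype.card Γ - C (1 : ℂ)) ?_ ?_
    · exact (Polynomial.separable_X_pow_sub_C (1 : ℂ)
        (by exact_mod_cast Fintype.card_ne_zero) one_ne_zero).squarefree
    · rw [map_sub, aeval_C, map_one, map_pow, aeval_X, ← map_pow, pow_card_eq_one, map_one,
        sub_self]
  have h' : ∀ g, ⨆ μ : ℂ, (F g).maxGenEigenspace μ = ⊤ := fun g =>
    Module.End.iSup_maxGenEigenspace_eq_top (F g)
  have htop :=
    Module.End.iSup_iInf_maxGenEigenspace_eq_top_of_iSup_maxGenEigenspace_eq_top_of_commute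
      (fun g => F g) hcomm h'
  have hind := Module.End.independent_iInf_maxGenEigenspace_of_forall_mapsTo (fun g => F g)
    (fun g h φ => Module.End.mapsTo_maxGenEigenspace_of_comm (hcomm' h g) φ)
  have e : ∀ χ : Γ → ℂ, (⨅ g, (F g).maxGenEigenspace (χ g)) = ⨅ g, (F g).eigenspace (χ g) :=
    fun χ => iInf_congr fun g => (hss g).isFinitelySemisimple.maxGenEigenspace_eq_eigenspace (χ g)
  simp only [e] at htop hind
  set W : (Γ → ℂ) → Submodule ℂ (Fin N → ℂ) := fun χ => ⨅ g, (F g).eigenspace (χ g) with hW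
  have hint : DirectSum.IsInternal W :=
    DirectSum.isInternal_submodule_of_iSupIndep_of_iSup_eq_top hind htop
  let b₀ := hint.collectedBasis fun χ => Module.finBasis ℂ (W χ)
  haveI : Fintype (Σ χ : Γ → ℂ, Fin (Module.finrank ℂ (W χ))) :=
    FiniteDimensional.fintypeBasisIndex b₀
  have hcard : Fintype.card (Σ χ : Γ → ℂ, Fin (Module.finrank ℂ (W χ))) = N := by
    rw [← Module.finrank_eq_card_basis b₀, Module.finrank_fin_fun]
  let eqv := Fintype.equivFinOfCardEq hcard
  refine ⟨b₀.reindex eqv, fun s => (eqv.symm s).1, fun s g => ?_⟩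
  have hmem : b₀ (eqv.symm s) ∈ W (eqv.symm s).1 := hint.collectedBasis_mem _ _
  rw [Module.Basis.reindex_apply]
  have h2 := (Submodule.mem_iInf _).1 hmem g
  rw [Module.End.mem_eigenspace_iff, hF] at h2
  exact h2

/-- **Simultaneous diagonalisation.** For a representation `ρ : Γ →* GL_N(ℂ)` of a finite
abelian group there are mutually inverse matrices `S, T` and characters `p_s : Γ →* ℂˣ` with
`T ρ(g) S = diag(p_1(g), …, p_N(g))` for every `g` (the weights of a common eigenbasis are
characters since the eigenvectors are non-zero). [folklore] -/
theorem exists_diagonalizer (ρ : Γ →* GL (Fin N) ℂ) :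
    ∃ (S T : Matrix (Fin N) (Fin N) ℂ) (p : Fin N → (Γ →* ℂˣ)), T * S = 1 ∧ S * T = 1 ∧
      ∀ g, T * (ρ g : Matrix (Fin N) (Fin N) ℂ) * S =
        Matrix.diagonal fun s => ((p s g : ℂˣ) : ℂ) := by
  classical
  obtain ⟨b, w, hw⟩ := exists_weight_basis ρ
  -- the weights of the (non-zero) basis vectors are characters
  have hmul : ∀ s g h, w s (g * h) = w s g * w s h := by
    intro s g h
    have h1 := hw s (g * h)
    rw [map_mul, Units.val_mul, ← Matrix.mulVec_mulVec, hw s h, Matrix.mulVec_smul, hw s g,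
      smul_smul, mul_comm (w s h)] at h1
    exact (smul_left_injective ℂ (b.ne_zero s) h1).symm
  have hone : ∀ s, w s 1 = 1 := by
    intro s
    have h1 := hw s 1
    rw [map_one, Units.val_one, Matrix.one_mulVec] at h1
    have h2 : (1 : ℂ) • b s = w s 1 • b s := by rw [one_smul]; exact h1
    exact (smul_left_injective ℂ (b.ne_zero s) h2).symm
  have hne : ∀ s g, w s g ≠ 0 := by
    intro s g h0
    have h1 := hmul s g g⁻¹
    rw [mul_inv_cancel, hone, h0, zero_mul] at h1
    exact one_ne_zero h1
  let p : Fin N → (Γ →* ℂˣ) := fun s =>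
    { toFun := fun g => Units.mk0 (w s g) (hne s g)
      map_one' := Units.ext (by simp [hone])
      map_mul' := fun g h => Units.ext (by simp [hmul]) }
  -- the base-change matrices
  let S : Matrix (Fin N) (Fin N) ℂ := (Pi.basisFun ℂ (Fin N)).toMatrix b
  let T : Matrix (Fin N) (Fin N) ℂ := b.toMatrix (Pi.basisFun ℂ (Fin N))
  have hTS : T * S = 1 := b.toMatrix_mul_toMatrix_flip _
  have hST : S * T = 1 := (Pi.basisFun ℂ (Fin N)).toMatrix_mul_toMatrix_flip _
  have hS : ∀ i s, S i s = b s i := by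
    intro i s
    simp [S, Module.Basis.toMatrix_apply]
  refine ⟨S, T, p, hTS, hST, fun g => ?_⟩
  have key : (ρ g : Matrix (Fin N) (Fin N) ℂ) * S =
      S * Matrix.diagonal fun s => ((p s g : ℂˣ) : ℂ) := by
    ext i s
    rw [Matrix.mul_apply, Matrix.mul_diagonal, hS]
    simp only [hS]
    have h1 := congrFun (hw s g) i
    simp only [Matrix.mulVec, dotProduct, Pi.smul_apply, smul_eq_mul] at h1
    rw [h1]
    simp [p, mul_comm]
  rw [Matrix.mul_assoc, key, ← Matrix.mul_assoc, hTS, Matrix.one_mul]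

end AbelianNoGo

end Summit.MatrixMultiplication.MatrixMultiplication.Theorems
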